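import Summits.RiemannHypothesis.RiemannHypothesis.Theorems.JensenLogBandArcTransform
import Literature.Analysis.Complex.HolomorphicParametricIntegral
import HarnessLib

/-!
# Route JensenLogBand, BAND crux (stmt-RiemannHypothesis-19913) — infrastructure:
# the half-arc transform `U_{n,h}(v)` is holomorphic in the centre `v` (RH-FREE)

Cell rh-jensen, LADDER-RH rung J-P(P3) «log band»; the BAND lead's LINE-PLAN (§3, `stub_nearZone`)
differentiates `x ↦ ‖U_{n,h}(x + iT)‖²` (h fixed). Here: for fixed `n` and `h > 0` the right half-arc
transform `xiSqArcU n h v = (n!/2πi) ∫_{-π/2}^{π/2} I_v(θ) dθ` (tree p481616) is HOLOMORPHIC in `v` on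
the open set `{h < 2‖v‖}` — the integrand `I_v(θ) = i h e^{iθ} · ξ₁((v + h e^{iθ})²) · K_{n,v}(v + h e^{iθ})`
is jointly continuous and, for each `θ`, holomorphic in `v` there (the kernel's denominator
`((v + h e^{iθ})² - v²)^{n+1}` does not vanish), so the tree's dominated-holomorphy theorem
`Literature.Analysis.Complex.differentiableOn_integral_of_dominated` (no derivative data needed)
applies with a local constant majorant from compactness.

* `differentiableOn_xiSqArcU` — `DifferentiableOn ℂ (xiSqArcU n h) {v | h < 2‖v‖}`;
* `differentiableAt_xiSqArcU`, `hasDerivAt_xiSqArcU_horizontal` — pointwise form and the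
  real-parameter derivative of `x ↦ U_{n,h}(x + iT)` (chain rule).

WHAT THIS IS NOT: regularity bookkeeping for the arc transform; nothing here bears on zeros of `ζ`
or the truth of RH. (prover-rh-jensen-eng-2-g5-0, 2026-08-27.)
-/

noncomputable section

open Complex Metric Set MeasureTheory Real

set_option linter.dupNamespace false

namespace Summit.RiemannHypothesis.RiemannHypothesis.Theorems.JensenPolynomials.LogBandArc

open Literature.NumberTheory.LFunctions

/-- The open set of admissible centres `{h < 2‖v‖}`. RH-FREE. -/
theorem isOpen_setOf_lt_two_mul_norm (h : ℝ) : IsOpen {v : ℂ | h < 2 * ‖v‖} :=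
  isOpen_lt continuous_const (continuous_const.mul continuous_norm)

/-- The arc integrand with the derivative of the circle map made explicit. RH-FREE. -/
theorem arcIntegrandU_eq (n : ℕ) (h : ℝ) (v : ℂ) (θ : ℝ) :
    arcIntegrandU n h v θ = circleMap 0 h θ * I *
      (xiSq (circleMap v h θ ^ 2) * (2 * circleMap v h θ *
        ((circleMap v h θ ^ 2 - v ^ 2) ^ (n + 1))⁻¹)) := by
  rw [arcIntegrandU, deriv_circleMap, sqKernel]

/-- Joint continuity of `(v, θ) ↦ I_v(θ)` on `{h < 2‖v‖} × ℝ` (`h > 0`). RH-FREE. -/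
theorem continuousOn_arcIntegrandU_uncurry (n : ℕ) {h : ℝ} (hh : 0 < h) :
    ContinuousOn (fun p : ℂ × ℝ => arcIntegrandU n h p.1 p.2) ({v : ℂ | h < 2 * ‖v‖} ×ˢ univ) := by
  have hcm : Continuous fun p : ℂ × ℝ => circleMap p.1 h p.2 := by
    unfold circleMap
    fun_prop
  have hc0 : Continuous fun p : ℂ × ℝ => circleMap 0 h p.2 := by
    unfold circleMap
    fun_prop
  have hden : ∀ p ∈ ({v : ℂ | h < 2 * ‖v‖} ×ˢ (univ : Set ℝ)),
      (circleMap p.1 h p.2 ^ 2 - p.1 ^ 2) ^ (n + 1) ≠ 0 := by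
    rintro ⟨v, θ⟩ ⟨hv, -⟩
    exact pow_ne_zero _ (sq_sub_sq_ne_zero_of_mem_sphere hh hv (circleMap_mem_sphere v hh.le θ))
  have hF : ContinuousOn (fun p : ℂ × ℝ => circleMap 0 h p.2 * I *
      (xiSq (circleMap p.1 h p.2 ^ 2) * (2 * circleMap p.1 h p.2 *
        ((circleMap p.1 h p.2 ^ 2 - p.1 ^ 2) ^ (n + 1))⁻¹))) ({v : ℂ | h < 2 * ‖v‖} ×ˢ univ) := by
    refine ((hc0.mul continuous_const).continuousOn).mul ?_
    refine ((differentiable_xiSq.continuous.comp (hcm.pow 2)).continuousOn).mul ?_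
    refine ((continuous_const.mul hcm).continuousOn).mul ?_
    exact ContinuousOn.inv₀ (by fun_prop) hden
  refine hF.congr ?_
  intro p _
  exact arcIntegrandU_eq n h p.1 p.2

/-- For each angle, `v ↦ I_v(θ)` is holomorphic on `{h < 2‖v‖}` (`h > 0`). RH-FREE. -/
theorem differentiableOn_arcIntegrandU_centre (n : ℕ) {h : ℝ} (hh : 0 < h) (θ : ℝ) :
    DifferentiableOn ℂ (fun v : ℂ => arcIntegrandU n h v θ) {v : ℂ | h < 2 * ‖v‖} := by
  intro v hv
  have hv' : h < 2 * ‖v‖ := hv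
  apply DifferentiableAt.differentiableWithinAt
  have hcm : Differentiable ℂ fun w : ℂ => circleMap w h θ := by
    unfold circleMap
    fun_prop
  have hden : (circleMap v h θ ^ 2 - v ^ 2) ^ (n + 1) ≠ 0 :=
    pow_ne_zero _ (sq_sub_sq_ne_zero_of_mem_sphere hh hv' (circleMap_mem_sphere v hh.le θ))
  have e : (fun w : ℂ => arcIntegrandU n h w θ) = fun w : ℂ => circleMap 0 h θ * I *
      (xiSq (circleMap w h θ ^ 2) * (2 * circleMap w h θ *
        ((circleMap w h θ ^ 2 - w ^ 2) ^ (n + 1))⁻¹)) := funext fun w => arcIntegrandU_eq n h w θ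
  rw [e]
  refine (differentiableAt_const _).mul ?_
  refine ((differentiable_xiSq.comp (hcm.pow 2)).differentiableAt).mul ?_
  refine ((differentiableAt_const _).mul (hcm v)).mul ?_
  exact DifferentiableAt.inv (by fun_prop) hden

/-- **The half-arc transform is holomorphic in the centre:** for `h > 0`,
`DifferentiableOn ℂ (xiSqArcU n h) {v | h < 2‖v‖}`. RH-FREE. -/
theorem differentiableOn_xiSqArcU (n : ℕ) {h : ℝ} (hh : 0 < h) :
    DifferentiableOn ℂ (xiSqArcU n h) {v : ℂ | h < 2 * ‖v‖} := by
  set U : Set ℂ := {v : ℂ | h < 2 * ‖v‖} with hU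
  have hUo : IsOpen U := isOpen_setOf_lt_two_mul_norm h
  have hpi : -(π / 2) ≤ π / 2 := by linarith [Real.pi_pos]
  -- the interval integral as a set integral over `Ioc (-π/2) (π/2)`
  set μ : Measure ℝ := volume.restrict (Ioc (-(π / 2)) (π / 2)) with hμ
  have hint : DifferentiableOn ℂ (fun v : ℂ => ∫ θ, arcIntegrandU n h v θ ∂μ) U := by
    refine Literature.Analysis.Complex.differentiableOn_integral_of_dominated
      (F := fun (v : ℂ) (θ : ℝ) => arcIntegrandU n h v θ) (μ := μ) ?_ ?_ ?_
    · intro v hv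
      exact (continuous_arcIntegrandU n hh hv).aestronglyMeasurable
    · exact Filter.Eventually.of_forall fun θ => differentiableOn_arcIntegrandU_centre n hh θ
    · intro x₀ hx₀
      have hx₀' : h < 2 * ‖x₀‖ := hx₀
      set R : ℝ := (2 * ‖x₀‖ - h) / 4 with hR
      have hR0 : 0 < R := by rw [hR]; linarith
      have hball : closedBall x₀ R ⊆ U := by
        intro p hp
        have hp' : ‖p - x₀‖ ≤ R := mem_closedBall_iff_norm.1 hp
        have : ‖x₀‖ - R ≤ ‖p‖ := by
          have := norm_sub_norm_le x₀ p
          rw [norm_sub_rev] at this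
          linarith
        show h < 2 * ‖p‖
        rw [hR] at this
        linarith
      -- a uniform bound on the compact set `closedBall x₀ R × [-π/2, π/2]`
      have hK : IsCompact (closedBall x₀ R ×ˢ Icc (-(π / 2)) (π / 2)) :=
        (isCompact_closedBall x₀ R).prod isCompact_Icc
      have hcont : ContinuousOn (fun p : ℂ × ℝ => arcIntegrandU n h p.1 p.2)
          (closedBall x₀ R ×ˢ Icc (-(π / 2)) (π / 2)) :=
        (continuousOn_arcIntegrandU_uncurry n hh).mono (prod_mono hball (subset_univ _))
      obtain ⟨M, hM⟩ := hK.exists_bound_of_continuousOn hcont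
      refine ⟨R, hR0, ball_subset_closedBall.trans hball, fun _ => M, ?_, ?_⟩
      · rw [hμ]
        show IntegrableOn (fun _ : ℝ => M) (Ioc (-(π / 2)) (π / 2)) volume
        exact integrableOn_const (hs := measure_Ioc_lt_top.ne)
      · rw [hμ, ae_restrict_iff' measurableSet_Ioc]
        refine Filter.Eventually.of_forall fun θ hθ p hp => ?_
        exact hM (p, θ) ⟨ball_subset_closedBall hp, Ioc_subset_Icc_self hθ⟩
  have e : xiSqArcU n h = fun v : ℂ =>
      (n.factorial : ℂ) / (2 * π * I) * ∫ θ, arcIntegrandU n h v θ ∂μ := by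
    funext v
    rw [xiSqArcU, intervalIntegral.integral_of_le hpi]
  rw [e]
  exact hint.const_mul _

/-- Pointwise form: `U_{n,h}` is complex-differentiable at every admissible centre. RH-FREE. -/
theorem differentiableAt_xiSqArcU (n : ℕ) {h : ℝ} (hh : 0 < h) {v : ℂ} (hv : h < 2 * ‖v‖) :
    DifferentiableAt ℂ (xiSqArcU n h) v :=
  (differentiableOn_xiSqArcU n hh v hv).differentiableAt
    ((isOpen_setOf_lt_two_mul_norm h).mem_nhds hv)

/-- **Real-parameter derivative along a horizontal line** (chain rule): for `h > 0` and
`h < 2‖x + iT‖`, `x ↦ U_{n,h}(x + iT)` has derivative `(U_{n,h})'(x + iT)` at `x`. RH-FREE. -/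
theorem hasDerivAt_xiSqArcU_horizontal (n : ℕ) {h : ℝ} (hh : 0 < h) (T : ℝ) {x : ℝ}
    (hv : h < 2 * ‖((x : ℂ) + (T : ℂ) * I)‖) :
    HasDerivAt (fun y : ℝ => xiSqArcU n h ((y : ℂ) + (T : ℂ) * I))
      (deriv (xiSqArcU n h) ((x : ℂ) + (T : ℂ) * I)) x := by
  have hU := (differentiableAt_xiSqArcU n hh hv).hasDerivAt
  have hlin : HasDerivAt (fun y : ℝ => ((y : ℂ) + (T : ℂ) * I)) 1 x := by
    have h1 : HasDerivAt (fun y : ℝ => (y : ℂ)) 1 x := by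
      simpa using (hasDerivAt_id x).ofReal_comp
    simpa using h1.add_const ((T : ℂ) * I)
  have h2 := hU.comp x hlin
  simpa [Function.comp_def] using h2

/-- **Differentiation under the integral sign for the arc transform:** for `h > 0` and
`h < 2‖v‖`, `U_{n,h}` has at `v` the derivative `(n!/2πi) ∫_{-π/2}^{π/2} ∂_v I_v(θ) dθ`
(the tree's `hasFDerivAt_integral_of_dominated_of_differentiableOn`: no hypothesis on the
derivative is needed). RH-FREE. (appended 2026-08-27, same seat) -/
theorem hasDerivAt_xiSqArcU (n : ℕ) {h : ℝ} (hh : 0 < h) {v : ℂ} (hv : h < 2 * ‖v‖) :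
    HasDerivAt (xiSqArcU n h)
      ((n.factorial : ℂ) / (2 * π * I) *
        ∫ θ in (-(π / 2))..(π / 2), deriv (fun w : ℂ => arcIntegrandU n h w θ) v) v := by
  set U : Set ℂ := {v : ℂ | h < 2 * ‖v‖} with hU
  have hpi : -(π / 2) ≤ π / 2 := by linarith [Real.pi_pos]
  set μ : Measure ℝ := volume.restrict (Ioc (-(π / 2)) (π / 2)) with hμ
  -- a ball about `v` inside `U` with a uniform bound
  set R : ℝ := (2 * ‖v‖ - h) / 4 with hR
  have hR0 : 0 < R := by rw [hR]; linarith
  have hball : closedBall v R ⊆ U := by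
    intro p hp
    have hp' : ‖p - v‖ ≤ R := mem_closedBall_iff_norm.1 hp
    have : ‖v‖ - R ≤ ‖p‖ := by
      have := norm_sub_norm_le v p
      rw [norm_sub_rev] at this
      linarith
    show h < 2 * ‖p‖
    rw [hR] at this
    linarith
  have hK : IsCompact (closedBall v R ×ˢ Icc (-(π / 2)) (π / 2)) :=
    (isCompact_closedBall v R).prod isCompact_Icc
  have hcont : ContinuousOn (fun p : ℂ × ℝ => arcIntegrandU n h p.1 p.2)
      (closedBall v R ×ˢ Icc (-(π / 2)) (π / 2)) :=
    (continuousOn_arcIntegrandU_uncurry n hh).mono (prod_mono hball (subset_univ _))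
  obtain ⟨M, hM⟩ := hK.exists_bound_of_continuousOn hcont
  have hmeas : ∀ p ∈ ball v R, AEStronglyMeasurable (fun θ => arcIntegrandU n h p θ) μ :=
    fun p hp => (continuous_arcIntegrandU n hh (hball (ball_subset_closedBall hp))).aestronglyMeasurable
  have hdiff : ∀ᵐ θ ∂μ, DifferentiableOn ℂ (fun p : ℂ => arcIntegrandU n h p θ) (ball v R) :=
    Filter.Eventually.of_forall fun θ =>
      (differentiableOn_arcIntegrandU_centre n hh θ).mono (ball_subset_closedBall.trans hball)
  have hbound : Integrable (fun _ : ℝ => M) μ := by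
    rw [hμ]
    show IntegrableOn (fun _ : ℝ => M) (Ioc (-(π / 2)) (π / 2)) volume
    exact integrableOn_const (hs := measure_Ioc_lt_top.ne)
  have hFb : ∀ᵐ θ ∂μ, ∀ p ∈ ball v R, ‖arcIntegrandU n h p θ‖ ≤ M := by
    rw [hμ, ae_restrict_iff' measurableSet_Ioc]
    exact Filter.Eventually.of_forall fun θ hθ p hp =>
      hM (p, θ) ⟨ball_subset_closedBall hp, Ioc_subset_Icc_self hθ⟩
  obtain ⟨L, hL, hLd⟩ :=
    Literature.Analysis.Complex.hasFDerivAt_integral_of_dominated_of_differentiableOn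
      (F := fun (p : ℂ) (θ : ℝ) => arcIntegrandU n h p θ) (μ := μ) hR0 hmeas hdiff hbound hFb
  -- from the Fréchet derivative to the complex derivative
  have hD : HasDerivAt (fun p : ℂ => ∫ θ, arcIntegrandU n h p θ ∂μ) (L 1) v :=
    hLd.hasDerivAt
  have hL1 : L 1 = ∫ θ, deriv (fun w : ℂ => arcIntegrandU n h w θ) v ∂μ := by
    rw [hL 1]
    refine integral_congr_ae (Filter.Eventually.of_forall fun θ => ?_)
    simp only [fderiv_apply_one_eq_deriv]
  have e : xiSqArcU n h = fun p : ℂ =>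
      (n.factorial : ℂ) / (2 * π * I) * ∫ θ, arcIntegrandU n h p θ ∂μ := by
    funext p
    rw [xiSqArcU, intervalIntegral.integral_of_le hpi]
  rw [e, intervalIntegral.integral_of_le hpi, ← hL1]
  exact hD.const_mul _

/-! ## The centre-derivative of the kernel and of the arc integrand (the `Λ`-formula)
(appended 2026-08-27, same seat; RH-FREE) -/

/-- `circleMap w h θ = w + circleMap 0 h θ`. RH-FREE. -/
theorem circleMap_eq_add_circleMap_zero (w : ℂ) (h θ : ℝ) :
    circleMap w h θ = w + circleMap 0 h θ := by
  rw [← circleMap_sub_center w h θ, add_sub_cancel]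

/-- **Centre-derivative of the kernel along the moving arc point `u = w + k`, `k = h e^{iθ}`
fixed:** `∂_w K_{n,w}(w + k) = 2·((u² - v²)^{n+1})⁻¹·(1 - 2(n+1)·u/(u+v))` at `w = v`
(`u = v + k`; `h > 0`, `h < 2‖v‖` so that `u + v ≠ 0`, `u² - v² ≠ 0`). RH-FREE. -/
theorem hasDerivAt_sqKernel_centre (n : ℕ) {h : ℝ} (hh : 0 < h) {v : ℂ} (hv : h < 2 * ‖v‖)
    (θ : ℝ) :
    HasDerivAt (fun w : ℂ => sqKernel n w (circleMap w h θ))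
      (2 * ((circleMap v h θ ^ 2 - v ^ 2) ^ (n + 1))⁻¹ *
        (1 - 2 * ((n : ℂ) + 1) * circleMap v h θ / (circleMap v h θ + v))) v := by
  set k : ℂ := circleMap 0 h θ with hk
  have hk0 : k ≠ 0 := by
    rw [hk]; simpa using circleMap_ne_center hh.ne' (c := (0 : ℂ)) (θ := θ)
  have hu : circleMap v h θ = v + k := circleMap_eq_add_circleMap_zero v h θ
  have hupv : circleMap v h θ + v ≠ 0 :=
    add_ne_zero_of_mem_closedBall hv (sphere_subset_closedBall (circleMap_mem_sphere v hh.le θ))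
  have hm : 2 * v + k ≠ 0 := by
    intro h0; apply hupv; rw [hu]; linear_combination h0
  have hD : (circleMap v h θ ^ 2 - v ^ 2) ^ (n + 1) ≠ 0 :=
    pow_ne_zero _ (sq_sub_sq_ne_zero_of_mem_sphere hh hv (circleMap_mem_sphere v hh.le θ))
  -- rewrite the function: `K_{n,w}(w+k) = 2(w+k)·((k(2w+k))^{n+1})⁻¹`
  have hfun : (fun w : ℂ => sqKernel n w (circleMap w h θ)) =
      fun w : ℂ => 2 * (w + k) * ((k * (2 * w + k)) ^ (n + 1))⁻¹ := by
    funext w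
    rw [sqKernel, circleMap_eq_add_circleMap_zero w h θ, ← hk]
    congr 2
    ring
  rw [hfun]
  -- derivative of `g(w) = (k(2w+k))^{n+1}`
  have hg : HasDerivAt (fun w : ℂ => (k * (2 * w + k)) ^ (n + 1))
      (((n + 1 : ℕ) : ℂ) * (k * (2 * v + k)) ^ n * (k * 2)) v := by
    have hlin : HasDerivAt (fun w : ℂ => k * (2 * w + k)) (k * 2) v := by
      have h1 : HasDerivAt (fun w : ℂ => 2 * w + k) (2 * 1) v :=
        ((hasDerivAt_id' v).const_mul 2).add_const k
      simpa using h1.const_mul k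
    simpa using hlin.fun_pow (n + 1)
  have hgv : (k * (2 * v + k)) ^ (n + 1) ≠ 0 := pow_ne_zero _ (mul_ne_zero hk0 hm)
  have hginv := hg.inv hgv
  have hlin2 : HasDerivAt (fun w : ℂ => 2 * (w + k)) 2 v := by
    simpa using ((hasDerivAt_id' v).add_const k).const_mul 2
  have hprod := hlin2.mul hginv
  -- identify the two denominators
  have hDk : (circleMap v h θ ^ 2 - v ^ 2) ^ (n + 1) = (k * (2 * v + k)) ^ (n + 1) := by
    rw [hu]; congr 1; ring
  have hm' : v + k + v ≠ 0 := by rw [← hu]; exact hupv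
  refine hprod.congr_deriv ?_
  simp only [Pi.inv_apply]
  rw [hDk, hu]
  push_cast
  field_simp
  ring

/-- **Centre-derivative of the arc integrand (the `Λ`-formula, division-free in `ξ₁`):**
with `u = v + h e^{iθ}`, `D = (u² - v²)^{n+1}`,
`∂_v I_v(θ) = i h e^{iθ}·[ξ₁′(u²)·2u·K_{n,v}(u) + ξ₁(u²)·2D⁻¹(1 - 2(n+1)u/(u+v))]`
(`= I_v(θ)·[2u ξ₁′(u²)/ξ₁(u²) + 1/u - 2(n+1)/(u+v)]` wherever `ξ₁(u²) ≠ 0`). RH-FREE. -/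
theorem hasDerivAt_arcIntegrandU_centre (n : ℕ) {h : ℝ} (hh : 0 < h) {v : ℂ}
    (hv : h < 2 * ‖v‖) (θ : ℝ) :
    HasDerivAt (fun w : ℂ => arcIntegrandU n h w θ)
      (circleMap 0 h θ * I *
        (deriv xiSq (circleMap v h θ ^ 2) * (2 * circleMap v h θ) * sqKernel n v (circleMap v h θ) +
          xiSq (circleMap v h θ ^ 2) * (2 * ((circleMap v h θ ^ 2 - v ^ 2) ^ (n + 1))⁻¹ *
            (1 - 2 * ((n : ℂ) + 1) * circleMap v h θ / (circleMap v h θ + v))))) v := by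
  set k : ℂ := circleMap 0 h θ with hk
  have hu : ∀ w : ℂ, circleMap w h θ = w + k := fun w => circleMap_eq_add_circleMap_zero w h θ
  -- `w ↦ ξ₁((w+k)²)`
  have hsq : HasDerivAt (fun w : ℂ => circleMap w h θ ^ 2) (2 * circleMap v h θ) v := by
    have h1 : HasDerivAt (fun w : ℂ => w + k) 1 v := (hasDerivAt_id' v).add_const k
    have h2 := h1.fun_pow 2
    simp only [hu]
    refine h2.congr_deriv ?_
    simp
  have hxi : HasDerivAt (fun w : ℂ => xiSq (circleMap w h θ ^ 2))
      (deriv xiSq (circleMap v h θ ^ 2) * (2 * circleMap v h θ)) v :=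
    (differentiable_xiSq _).hasDerivAt.comp v hsq
  have hK := hasDerivAt_sqKernel_centre n hh hv θ
  have hprod := (hxi.mul hK).const_mul (k * I)
  have hfun : (fun w : ℂ => arcIntegrandU n h w θ) =
      fun w : ℂ => k * I * (xiSq (circleMap w h θ ^ 2) * sqKernel n w (circleMap w h θ)) := by
    funext w
    rw [arcIntegrandU, deriv_circleMap, hk]
  rw [hfun]
  refine hprod.congr_deriv ?_
  ring

end Summit.RiemannHypothesis.RiemannHypothesis.Theorems.JensenPolynomials.LogBandArc
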